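import Summits.CriticalPhenomena.PercolationContinuityZ3.Theorems.SahiMasterFamilyPrincipalDomination

/-!
# The `k → k+1` step of the master statement OFF THE RESIDUAL CLASS, every `k`: positivity and the zero locus

Assembly file (crux `NoHeavyLowerTail`, stmt-CriticalPhenomena-4575; cell `prim-masterthm`, unit `prim-masterthm-p4` = "induction on
`k` through the FKG-lattice structure + the equality locus").  Vocabulary: `SahiMasterFamily.lean` (`sahiE` = Sahi's `E_k`
[Sahi2008; LiebSahi2021, Def. 3.1], `bernoulliWeight p`, `ind`, `MasterFamilyNonneg k` = `C_k` on product measures — OPEN for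
`k ≥ 3` [Kahn2022, Conj. 5] —, `MasterFamilyEqIff k` = the conjectured zero locus `Z_k = SuppZeroFlag k`, OPEN for `k ≥ 3`,
`DeterminedBy`).

THE TYPED INDUCTIVE STEP.  Peeling the Lieb–Sahi recursion at a slot `m` (`sahiE_peel`),
  `E_{k+3}(U) = Σ_l E_{k+2}(U_{−m}; U_l ↦ U_l ∩ U_m) − P(U_m)·E_{k+2}(U_{−m})`,
reduces BOTH halves of the master statement of order `k + 3` — positivity `(M)` and the zero locus `(EQ)` — to order `k + 2`
whenever the loss term `P(U_m)E_{k+2}(U_{−m})` can be charged to the gains by a PROVED all-`k` identity/inequality.  Four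
strata carry such a rule (the "reducible" strata of the unit's HP-reducibility census, MASTER-ROUTES §P4.3):
* (R4) a COMPARABLE pair `U_j ⊆ U_i` — absorption, `SahiMasterFamilyComparableStep` (`sahiE_ind_nonneg_of_subset'`,
  `sahiE_ind_eq_zero_iff_of_subset`);
* (R5) a CYLINDER member `{ω | S ⊆ ω}` — Blinovsky's conditioning identity [Blinovsky2013] for positivity
  (`Literature…sahiE_bernoulliWeight_ind_nonneg_offK`) and the principal-slot DOMINATION inequality for the zero locus
  (`SahiMasterFamilyPrincipalDomination.sahiE_ind_eq_zero_iff_of_cylinder`);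
* (R3) an INDEPENDENT member (determined by a coordinate set `F` while all other members are determined by `Fᶜ`) — splitting
  `E_{k+3}(1_H, 1_U) = (k+1)P(H)E_{k+2}(1_U)` [LiebSahi2021, Prop. 3.4] (`Literature…sahiE_bernoulliWeight_ind_cons_eq_of_determinedBy`);
* (R6) a deleted family `U_{−m}` in `Z_{k+2}` — the peeled step `SahiMasterFamilyHeredity.masterFamily_step`.
RESULTS: `sahiE_ind_nonneg_of_not_residual` — GIVEN `MasterFamilyNonneg (k+2)`, on the union of the four strata `E_{k+3}(μ_p; 1_U) ≥ 0`
(every `p ∈ [0,1]^ι`); `sahiE_ind_eq_zero_iff_of_not_residual` — GIVEN `MasterFamilyEqIff (k+2)` (which contains `MasterFamilyNonneg (k+2)`),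
for `p` interior, `E_{k+3}(μ_p; 1_U) = 0 ↔ U ∈ Z_{k+3}` there.  Unconditional at order 3 (`…three…`, the cell's
`sahiE_three_ind_nonneg_of_not_residual` / `sahiE_three_ind_eq_zero_iff_of_not_residual` with the independent-member stratum
spelled out), and at order 4 given `MasterFamilyEqIff 3` alone (`sahiE_four_ind_eq_zero_iff_of_not_residual`).
ALSO: `sahiE_ind_cylinder_ge_prod` — iterating the domination inequality down to Harris, GIVEN `MasterFamilyNonneg (k+1)`:
`E_{k+2}(μ_p; 1_P, 1_{U_0},…,1_{U_k}) ≥ P(P)·∏_l [P_{p'}(U_l) − P(U_l)] = ∏_l Cov(U_l,P)/P(P)^k` (equality at order 2; unconditional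
at order 3: `E_3(P,A,B) ≥ Cov(A,P)Cov(B,P)/P(P)`).
`masterFamilyEqIff_succ_iff_ne_zero_on_residual`: GIVEN `MasterFamilyEqIff (k+2)`, (EQ-(k+3)) ⟺ "`E_{k+3} ≠ 0` on the
residual class" (the complement of the four strata; unconditionally at order 3: `masterFamilyEqIff_three_iff_ne_zero_on_residual`).
THE RESIDUAL CLASS `𝓡_{k+3}` (where no all-`k` rule is known) is the complement: ANTICHAINS of events, none a cylinder, none
independent of the rest, no deleted family in `Z_{k+2}`; its census size (unit notes): 0.19 % / 11.7 % / 44.2 % of triples on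
`{0,1}^3 / {0,1}^4 / {0,1}^5`, 21.5 % of quadruples on `{0,1}^4` (the recursive census also descends into sub-families, so its
residual is slightly smaller than the one-step class here).  HONEST FRAMING: nothing here asserts `C_k` or (EQ-k), `k ≥ 3`. [this work]
-/

set_option autoImplicit false

open Finset
open scoped Classical

namespace Summit.CriticalPhenomena.PercolationContinuityZ3.Theorems

open Literature.Combinatorics.Sahi2008
open MeasureTheory Function
open Literature.Probability.LatticeModels (prodBernoulli)
open Literature.Probability.Percolation (DeterminedBy)
open Literature.Probability.Percolation.DecisionTree (ind ind_of_mem ind_of_not_mem ind_nonneg)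

variable {ι : Type} [Fintype ι]

/-- In the open cube, `E(1_V) = 0` forces `V = ∅`. [folklore] -/
theorem eq_empty_of_ex_ind_eq_zero {p : ι → unitInterval} (hp : ∀ e, (p e : ℝ) ∈ Set.Ioo (0 : ℝ) 1)
    {V : Set (Set ι)} (hV : ex (bernoulliWeight p) (ind V) = 0) : V = ∅ := by
  rw [ex, Finset.sum_eq_zero_iff_of_nonneg fun ω _ =>
    mul_nonneg (bernoulliWeight_pos hp ω).le (ind_nonneg _ _)] at hV
  ext ω
  simp only [Set.mem_empty_iff_false, iff_false]
  intro hω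
  have h1 := hV ω (Finset.mem_univ ω)
  rw [ind_of_mem hω, mul_one] at h1
  exact (bernoulliWeight_pos hp ω).ne' h1

/-- Moving slot `m` to the head: `E_{n+1}(U) = E_{n+1}(1_{U_m}, (1_{U_{m.succAbove (τ j)}})_j)` for a permutation `τ`
(symmetry of `E_n`). [cite: LiebSahi2021, Def. 3.1 (symmetry of `E_n`)] -/
theorem exists_perm_sahiE_ind_eq_cons {n : ℕ} (μ : Set ι → ℝ) (U : Fin (n + 2) → Set (Set ι)) (m : Fin (n + 2)) :
    ∃ τ : Equiv.Perm (Fin (n + 1)),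
      sahiE μ (n + 2) (fun j => ind (U j)) =
        sahiE μ (n + 2) (Matrix.vecCons (ind (U m)) fun j => ind (U (m.succAbove (τ j)))) := by
  set σ : Equiv.Perm (Fin (n + 2)) := Equiv.swap 0 m with hσ_def
  obtain ⟨τ, hτ⟩ := exists_perm_succAbove_comp σ 0
  refine ⟨τ, ?_⟩
  rw [← sahiE_ind_comp_perm μ σ U]
  congr 1
  funext j
  refine Fin.cases ?_ (fun l => ?_) j
  · simp [hσ_def]
  · rw [Matrix.cons_val_succ, ← Fin.succAbove_zero, hτ l]
    simp [hσ_def]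

/-- **Positivity off the residual class (every `k`).**  GIVEN `MasterFamilyNonneg (k+2)`, a family of `k + 3` increasing events with
a comparable pair, OR a cylinder member, OR a member independent of all the others, OR a deleted family in `Z_{k+2}`, has
`E_{k+3}(μ_p; 1_U) ≥ 0` for every `p ∈ [0,1]^ι`. [this work] -/
theorem sahiE_ind_nonneg_of_not_residual {k : ℕ} (hN : MasterFamilyNonneg (k + 2)) (p : ι → unitInterval)
    (U : Fin (k + 3) → Set (Set ι)) (hU : ∀ j, IsUpperSet (U j))
    (h : (∃ i j : Fin (k + 3), j ≠ i ∧ U j ⊆ U i) ∨ (∃ (m : Fin (k + 3)) (S : Set ι), U m = {ω : Set ι | S ⊆ ω}) ∨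
      (∃ (m : Fin (k + 3)) (F : Finset ι), DeterminedBy (U m) (↑F : Set ι) ∧
        ∀ j, DeterminedBy (U (m.succAbove j)) (↑F : Set ι)ᶜ) ∨
      (∃ m : Fin (k + 3), SuppZeroFlag (k + 2) (fun j => U (m.succAbove j)))) :
    0 ≤ sahiE (bernoulliWeight p) (k + 3) (fun j => ind (U j)) := by
  rcases h with ⟨i, j, hij, hsub⟩ | ⟨m, S, hm⟩ | ⟨m, F, hF, hFc⟩ | ⟨m, hZ⟩
  · exact sahiE_ind_nonneg_of_subset' hN p U hU hij hsub
  · have hC : ∀ q : ι → unitInterval, SahiPositive (bernoulliWeight q) (k + 2) :=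
      (masterFamilyNonneg_iff_sahiPositive (k + 2)).1 hN ι
    refine sahiE_bernoulliWeight_ind_nonneg_offK (k + 2) hC p U (univ.erase m) ?_ (fun i _ => hU i) (fun _ => S) ?_
    · rw [Finset.card_erase_of_mem (Finset.mem_univ m), Finset.card_univ, Fintype.card_fin]; omega
    · intro i hi
      have : i = m := by simpa using hi
      rw [this, hm]
  · obtain ⟨τ, hτ⟩ := exists_perm_sahiE_ind_eq_cons (bernoulliWeight p) U m
    rw [hτ]
    refine sahiE_bernoulliWeight_ind_cons_nonneg_of_determinedBy p F hF (A := fun j => U (m.succAbove (τ j)))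
      (fun j => hFc (τ j)) ?_
    rw [sahiE_ind_comp_perm (bernoulliWeight p) τ (fun j => U (m.succAbove j))]
    exact hN ι p _ fun j => hU _
  · exact sahiE_ind_nonneg_of_subfamily hN p U hU m hZ

/-- **The zero locus off the residual class (every `k`).**  GIVEN `MasterFamilyEqIff (k+2)`, for `p` in the open cube, a family of
`k + 3` increasing events with a comparable pair, OR a cylinder member, OR a member independent of all the others, OR a deleted
family in `Z_{k+2}`, has `E_{k+3}(μ_p; 1_U) = 0 ↔ U ∈ Z_{k+3}`. [this work] -/
theorem sahiE_ind_eq_zero_iff_of_not_residual {k : ℕ} (hE : MasterFamilyEqIff (k + 2)) (p : ι → unitInterval)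
    (hp : ∀ e, (p e : ℝ) ∈ Set.Ioo (0 : ℝ) 1) (U : Fin (k + 3) → Set (Set ι)) (hU : ∀ j, IsUpperSet (U j))
    (h : (∃ i j : Fin (k + 3), j ≠ i ∧ U j ⊆ U i) ∨ (∃ (m : Fin (k + 3)) (S : Set ι), U m = {ω : Set ι | S ⊆ ω}) ∨
      (∃ (m : Fin (k + 3)) (F : Finset ι), DeterminedBy (U m) (↑F : Set ι) ∧
        ∀ j, DeterminedBy (U (m.succAbove j)) (↑F : Set ι)ᶜ) ∨
      (∃ m : Fin (k + 3), SuppZeroFlag (k + 2) (fun j => U (m.succAbove j)))) :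
    sahiE (bernoulliWeight p) (k + 3) (fun j => ind (U j)) = 0 ↔ SuppZeroFlag (k + 3) U := by
  have hN : MasterFamilyNonneg (k + 2) := masterFamilyNonneg_of_masterFamilyEqIff hE
  refine ⟨fun h0 => ?_, fun hZ => masterFamilyEqIff_mpr (k + 3) ι p U hZ⟩
  rcases h with ⟨i, j, hij, hsub⟩ | ⟨m, S, hm⟩ | ⟨m, F, hF, hFc⟩ | ⟨m, hZ⟩
  · obtain ⟨l₀, hl₀⟩ := Fin.exists_succAbove_eq hij
    exact (sahiE_ind_eq_zero_iff_of_subset hN hE p hp U hU i l₀ (hl₀ ▸ hsub)).1 h0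
  · exact (sahiE_ind_eq_zero_iff_of_cylinder hE p hp U hU m S hm).1 h0
  · -- independent member: either it is empty (then it is contained in any other member), or splitting
    by_cases hempty : U m = ∅
    · obtain ⟨i, hi⟩ : ∃ i : Fin (k + 3), i ≠ m := exists_ne m
      obtain ⟨l₀, hl₀⟩ := Fin.exists_succAbove_eq hi.symm
      refine (sahiE_ind_eq_zero_iff_of_subset hN hE p hp U hU i l₀ ?_).1 h0
      rw [hl₀, hempty]; exact Set.empty_subset _
    · obtain ⟨τ, hτ⟩ := exists_perm_sahiE_ind_eq_cons (bernoulliWeight p) U m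
      have hH0 : (prodBernoulli p).real (U m) ≠ 0 := by
        rw [← ex_bernoulliWeight_ind]
        exact fun h' => hempty (eq_empty_of_ex_ind_eq_zero hp h')
      have h1 := (sahiE_bernoulliWeight_ind_cons_eq_zero_iff_of_determinedBy p (Nat.succ_ne_zero k) F hF hH0
        (A := fun j => U (m.succAbove (τ j))) (fun j => hFc (τ j))).1 (hτ ▸ h0)
      rw [sahiE_ind_comp_perm (bernoulliWeight p) τ (fun j => U (m.succAbove j))] at h1
      have hZ : SuppZeroFlag (k + 2) (fun j => U (m.succAbove j)) := (hE ι p hp _ fun j => hU _).1 h1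
      exact (masterFamily_step hN hE p hp U hU m hZ).2.1 h0
  · exact (masterFamily_step hN hE p hp U hU m hZ).2.1 h0

/-- **Unconditionally at order 3** (Harris + strict Harris): Kahn's Conjecture 5 and (EQ-3) hold for every triple of increasing
events off the residual class `𝓡_3` (nested pair ∨ cylinder ∨ independent member ∨ independent pair). [this work] -/
theorem sahiE_three_ind_eq_zero_iff_of_not_residual' (p : ι → unitInterval) (hp : ∀ e, (p e : ℝ) ∈ Set.Ioo (0 : ℝ) 1)
    (U : Fin 3 → Set (Set ι)) (hU : ∀ j, IsUpperSet (U j))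
    (h : (∃ i j : Fin 3, j ≠ i ∧ U j ⊆ U i) ∨ (∃ (m : Fin 3) (S : Set ι), U m = {ω : Set ι | S ⊆ ω}) ∨
      (∃ (m : Fin 3) (F : Finset ι), DeterminedBy (U m) (↑F : Set ι) ∧ ∀ j, DeterminedBy (U (m.succAbove j)) (↑F : Set ι)ᶜ) ∨
      (∃ m : Fin 3, SuppZeroFlag 2 (fun j => U (m.succAbove j)))) :
    0 ≤ sahiE (bernoulliWeight p) 3 (fun j => ind (U j)) ∧
      (sahiE (bernoulliWeight p) 3 (fun j => ind (U j)) = 0 ↔ SuppZeroFlag 3 U) :=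
  ⟨sahiE_ind_nonneg_of_not_residual (masterFamilyNonneg_of_le_two le_rfl) p U hU h,
    sahiE_ind_eq_zero_iff_of_not_residual masterFamilyEqIff_two p hp U hU h⟩

/-- **At order 4, conditionally on `MasterFamilyEqIff 3`** (which contains Kahn's Conjecture 5): `E_4 ≥ 0` and `E_4 = 0 ↔ Z_4`
for quadruples of increasing events off the residual class `𝓡_4`. [this work] -/
theorem sahiE_four_ind_eq_zero_iff_of_not_residual (hE : MasterFamilyEqIff 3) (p : ι → unitInterval)
    (hp : ∀ e, (p e : ℝ) ∈ Set.Ioo (0 : ℝ) 1) (U : Fin 4 → Set (Set ι)) (hU : ∀ j, IsUpperSet (U j))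
    (h : (∃ i j : Fin 4, j ≠ i ∧ U j ⊆ U i) ∨ (∃ (m : Fin 4) (S : Set ι), U m = {ω : Set ι | S ⊆ ω}) ∨
      (∃ (m : Fin 4) (F : Finset ι), DeterminedBy (U m) (↑F : Set ι) ∧ ∀ j, DeterminedBy (U (m.succAbove j)) (↑F : Set ι)ᶜ) ∨
      (∃ m : Fin 4, SuppZeroFlag 3 (fun j => U (m.succAbove j)))) :
    0 ≤ sahiE (bernoulliWeight p) 4 (fun j => ind (U j)) ∧
      (sahiE (bernoulliWeight p) 4 (fun j => ind (U j)) = 0 ↔ SuppZeroFlag 4 U) :=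
  ⟨sahiE_ind_nonneg_of_not_residual (masterFamilyNonneg_of_masterFamilyEqIff hE) p U hU h,
    sahiE_ind_eq_zero_iff_of_not_residual hE p hp U hU h⟩

/-! ### A product lower bound on the principal stratum (iterated domination) -/

open Literature.Probability.LatticeModels (principalUp mem_principalUp) in
/-- `P(S ⊆ ω) = ∏_{e∈S} p_e`. [cite: Sahi2008, eq. (2) (p. 210)] -/
theorem ex_ind_cylinder_eq_prod (p : ι → unitInterval) (S : Set ι) :
    ex (bernoulliWeight p) (ind {ω : Set ι | S ⊆ ω}) = ∏ e, if e ∈ S then (p e : ℝ) else 1 := by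
  rw [← setInd_principalUp_eq_ind, ex_setInd]
  exact sum_principalUp_bernoulliWeight p S

open Literature.Probability.LatticeModels (principalUp mem_principalUp) in
/-- `P_p(A ∩ {S ⊆ ω}) = P_p(S ⊆ ω) · P_{p'}(A)` with `p'` = `p` frozen to `1` on `S`. [cite: Sahi2008, eq. (2) (p. 210)] -/
theorem ex_ind_mul_ind_cylinder_eq (p : ι → unitInterval) (S : Set ι) (A : Set (Set ι)) :
    ex (bernoulliWeight p) (ind A * ind {ω : Set ι | S ⊆ ω}) =
      (∏ e, if e ∈ S then (p e : ℝ) else 1) * ex (bernoulliWeight fun e => if e ∈ S then 1 else p e) (ind A) := by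
  rw [ex, ex, Finset.mul_sum]
  refine Finset.sum_congr rfl fun ω _ => ?_
  have hfr := freeze_mul_bernoulliWeight_eq p S ω
  rw [← setInd_principalUp_eq_ind, Pi.mul_apply, setInd_apply]
  calc bernoulliWeight p ω * (ind A ω * if ω ∈ principalUp S then 1 else 0)
      = (if ω ∈ principalUp S then bernoulliWeight p ω else 0) * ind A ω := by split_ifs <;> ring
    _ = (∏ e, if e ∈ S then (p e : ℝ) else 1) *
          (bernoulliWeight (fun e => if e ∈ S then 1 else p e) ω * ind A ω) := by rw [← hfr]; ring

/-- **Iterated domination: a product lower bound on the principal stratum (every `k`).**  GIVEN `MasterFamilyNonneg (k+1)`, for the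
cylinder `P = {ω | S ⊆ ω}`, increasing `U_0,…,U_k` and every `p ∈ [0,1]^ι`,
    `E_{k+2}(μ_p; 1_P, 1_{U_0},…,1_{U_k}) ≥ P_p(P) · ∏_l [P_{p'}(U_l) − P_p(U_l)]`   (`= ∏_l Cov_p(U_l, P) / P_p(P)^k` when `P_p(P) > 0`),
with EQUALITY at `k + 2 = 2` (Harris' covariance `Cov(P, U_0) = P(P)·[P(U_0|P) − P(U_0)]`); unconditional at order 3
(`E_3(P,A,B) ≥ Cov(A,P)Cov(B,P)/P(P)`, Blinovsky's third bracket), order 4 given Kahn's Conjecture 5.  It is the all-singletons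
partition term of `W` in the principal-slot identity. [this work] -/
theorem sahiE_ind_cylinder_ge_prod :
    ∀ {k : ℕ}, MasterFamilyNonneg (k + 1) → ∀ (p : ι → unitInterval) (S : Set ι) (U : Fin (k + 1) → Set (Set ι)),
      (∀ j, IsUpperSet (U j)) →
      ex (bernoulliWeight p) (ind {ω : Set ι | S ⊆ ω}) *
          ∏ l, (ex (bernoulliWeight fun e => if e ∈ S then 1 else p e) (ind (U l)) - ex (bernoulliWeight p) (ind (U l))) ≤
        sahiE (bernoulliWeight p) (k + 2) (Matrix.vecCons (ind {ω : Set ι | S ⊆ ω}) fun l => ind (U l))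
  | 0, _, p, S, U, _ => by
    -- `E_2(1_P, 1_U) = P(P ∩ U) − P(P)P(U) = P(P)·[P_{p'}(U) − P(U)]`
    rw [Fin.prod_univ_one, sahiE_two_apply, Matrix.cons_val_zero, Matrix.cons_val_one,
      mul_comm (ind {ω : Set ι | S ⊆ ω}) (ind (U 0)), ex_ind_mul_ind_cylinder_eq, ex_ind_cylinder_eq_prod]
    exact le_of_eq (by ring)
  | k + 1, hN, p, S, U, hU => by
    have hN' : MasterFamilyNonneg (k + 1) := masterFamilyNonneg_antitone (Nat.le_succ _) hN
    have ih := sahiE_ind_cylinder_ge_prod hN' p S (fun l : Fin (k + 1) => U l.castSucc) fun l => hU _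
    have hdom := sahiE_ind_cylinder_ge_erase hN p S U hU (Fin.last (k + 1))
    simp only [Fin.succAbove_last] at hdom
    set δ : Fin (k + 2) → ℝ := fun l =>
      ex (bernoulliWeight fun e => if e ∈ S then 1 else p e) (ind (U l)) - ex (bernoulliWeight p) (ind (U l)) with hδ_def
    by_cases hm : (∏ e, if e ∈ S then (p e : ℝ) else 1) = 0
    · -- `P(P) = 0`: the left side vanishes and the right side is `≥ δ_last · E_{k+2}(P, U') ≥ 0`? No — simpler: both functionals vanish.
      have hnull : ∀ ω ∈ Literature.Probability.LatticeModels.principalUp S, bernoulliWeight p ω = 0 := fun ω hω => by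
        have h := freeze_mul_bernoulliWeight_eq p S ω
        rw [if_pos hω, hm, zero_mul] at h
        exact h.symm
      rw [ex_ind_cylinder_eq_prod, hm, zero_mul, ← setInd_principalUp_eq_ind,
        sahiE_cons_setInd_eq_zero_of_null _ (sum_bernoulliWeight p) _ hnull]
    · have hmpos : 0 < ∏ e, if e ∈ S then (p e : ℝ) else 1 :=
        lt_of_le_of_ne (Finset.prod_nonneg fun e _ => by split_ifs; exacts [(p e).2.1, zero_le_one]) (Ne.symm hm)
      have hδlast : 0 ≤ δ (Fin.last (k + 1)) := by
        have h := sum_freeze_sub_mul_prod_ind_nonneg p S hmpos hU {Fin.last (k + 1)}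
        rw [hδ_def]; dsimp only
        rw [ex, ex, ← Finset.sum_sub_distrib]
        refine le_of_le_of_eq h (Finset.sum_congr rfl fun ω _ => ?_)
        rw [Finset.prod_singleton]; ring
      calc ex (bernoulliWeight p) (ind {ω : Set ι | S ⊆ ω}) * ∏ l, δ l
          = (ex (bernoulliWeight p) (ind {ω : Set ι | S ⊆ ω}) * ∏ l : Fin (k + 1), δ l.castSucc) * δ (Fin.last (k + 1)) := by
            rw [Fin.prod_univ_castSucc]; ring
        _ ≤ sahiE (bernoulliWeight p) (k + 2)
              (Matrix.vecCons (ind {ω : Set ι | S ⊆ ω}) fun l => ind (U l.castSucc)) * δ (Fin.last (k + 1)) :=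
            mul_le_mul_of_nonneg_right ih hδlast
        _ ≤ sahiE (bernoulliWeight p) (k + 3) (Matrix.vecCons (ind {ω : Set ι | S ⊆ ω}) fun l => ind (U l)) := by
            rw [mul_comm]; exact hdom

/-- **Unconditionally at order 3**: `E_3(μ_p; 1_P, 1_A, 1_B) ≥ P(P)·[P_{p'}(A) − P(A)]·[P_{p'}(B) − P(B)]` for a cylinder `P` and
increasing `A, B` (`= Cov(A,P)·Cov(B,P)/P(P)`). [this work] -/
theorem sahiE_three_ind_cylinder_ge_prod (p : ι → unitInterval) (S : Set ι) (A B : Set (Set ι)) (hA : IsUpperSet A)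
    (hB : IsUpperSet B) :
    ex (bernoulliWeight p) (ind {ω : Set ι | S ⊆ ω}) *
        ((ex (bernoulliWeight fun e => if e ∈ S then 1 else p e) (ind A) - ex (bernoulliWeight p) (ind A)) *
          (ex (bernoulliWeight fun e => if e ∈ S then 1 else p e) (ind B) - ex (bernoulliWeight p) (ind B))) ≤
      sahiE (bernoulliWeight p) 3 ![ind {ω : Set ι | S ⊆ ω}, ind A, ind B] := by
  have h := sahiE_ind_cylinder_ge_prod (masterFamilyNonneg_of_le_two le_rfl) p S ![A, B]
    (fun j => by fin_cases j <;> assumption)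
  rw [Fin.prod_univ_two] at h
  have e2 : (Matrix.vecCons (ind {ω : Set ι | S ⊆ ω}) fun l => ind ((![A, B] : Fin 2 → Set (Set ι)) l))
      = ![ind {ω : Set ι | S ⊆ ω}, ind A, ind B] := by
    funext j; fin_cases j <;> rfl
  rw [e2] at h
  exact h

/-! ### What is left of (EQ-(k+3)) given (EQ-(k+2)): non-vanishing on the residual class -/

/-- **What (EQ-(k+3)) says beyond (EQ-(k+2)): non-vanishing on the residual class.**  GIVEN `MasterFamilyEqIff (k+2)`,
`MasterFamilyEqIff (k+3)` holds iff `E_{k+3}(μ_p; 1_U) ≠ 0` for every `p` in the open cube and every RESIDUAL family of `k + 3`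
increasing events — residual = on none of the four strata: no comparable pair, no cylinder member, no member independent of the
others, no deleted family in `Z_{k+2}` (off the residual class the zero locus is already decided by
`sahiE_ind_eq_zero_iff_of_not_residual`, and the residual class contains no zero flag, since `Z_{k+3} ⊆` {some deleted family in
`Z_{k+2}`}).  The all-`k` form of the cell's "(EQ-3) ⟺ `E₃ ≠ 0` on `𝓡₃`". [this work] -/
theorem masterFamilyEqIff_succ_iff_ne_zero_on_residual {k : ℕ} (hE : MasterFamilyEqIff (k + 2)) :
    MasterFamilyEqIff (k + 3) ↔
      ∀ (ι : Type) [Fintype ι] (p : ι → unitInterval), (∀ e, (p e : ℝ) ∈ Set.Ioo (0 : ℝ) 1) →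
        ∀ U : Fin (k + 3) → Set (Set ι), (∀ j, IsUpperSet (U j)) →
          ¬ ((∃ i j : Fin (k + 3), j ≠ i ∧ U j ⊆ U i) ∨ (∃ (m : Fin (k + 3)) (S : Set ι), U m = {ω : Set ι | S ⊆ ω}) ∨
              (∃ (m : Fin (k + 3)) (F : Finset ι), DeterminedBy (U m) (↑F : Set ι) ∧
                ∀ j, DeterminedBy (U (m.succAbove j)) (↑F : Set ι)ᶜ) ∨
              (∃ m : Fin (k + 3), SuppZeroFlag (k + 2) (fun j => U (m.succAbove j)))) →
          sahiE (bernoulliWeight p) (k + 3) (fun j => ind (U j)) ≠ 0 := by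
  constructor
  · intro h ι _ p hp U hU hR h0
    obtain ⟨i, hi, -⟩ := (h ι p hp U hU).1 h0
    exact hR (Or.inr (Or.inr (Or.inr ⟨i, hi⟩)))
  · intro h ι _ p hp U hU
    by_cases hR : (∃ i j : Fin (k + 3), j ≠ i ∧ U j ⊆ U i) ∨ (∃ (m : Fin (k + 3)) (S : Set ι), U m = {ω : Set ι | S ⊆ ω}) ∨
        (∃ (m : Fin (k + 3)) (F : Finset ι), DeterminedBy (U m) (↑F : Set ι) ∧
          ∀ j, DeterminedBy (U (m.succAbove j)) (↑F : Set ι)ᶜ) ∨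
        (∃ m : Fin (k + 3), SuppZeroFlag (k + 2) (fun j => U (m.succAbove j)))
    · exact sahiE_ind_eq_zero_iff_of_not_residual hE p hp U hU hR
    · refine ⟨fun h0 => (h ι p hp U hU hR h0).elim, fun hZ => ?_⟩
      obtain ⟨i, hi, -⟩ := hZ
      exact (hR (Or.inr (Or.inr (Or.inr ⟨i, hi⟩)))).elim

/-- **Unconditionally: (EQ-3) ⟺ `E₃ ≠ 0` on the residual class `𝓡₃`** (antichains of non-cylinder increasing events with no
member independent of the other two, interior `p`).  By `masterFamilyNonneg_of_masterFamilyEqIff` the right-hand side also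
contains Kahn's Conjecture 5. [this work] -/
theorem masterFamilyEqIff_three_iff_ne_zero_on_residual :
    MasterFamilyEqIff 3 ↔
      ∀ (ι : Type) [Fintype ι] (p : ι → unitInterval), (∀ e, (p e : ℝ) ∈ Set.Ioo (0 : ℝ) 1) →
        ∀ U : Fin 3 → Set (Set ι), (∀ j, IsUpperSet (U j)) →
          ¬ ((∃ i j : Fin 3, j ≠ i ∧ U j ⊆ U i) ∨ (∃ (m : Fin 3) (S : Set ι), U m = {ω : Set ι | S ⊆ ω}) ∨
              (∃ (m : Fin 3) (F : Finset ι), DeterminedBy (U m) (↑F : Set ι) ∧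
                ∀ j, DeterminedBy (U (m.succAbove j)) (↑F : Set ι)ᶜ) ∨
              (∃ m : Fin 3, SuppZeroFlag 2 (fun j => U (m.succAbove j)))) →
          sahiE (bernoulliWeight p) 3 (fun j => ind (U j)) ≠ 0 :=
  masterFamilyEqIff_succ_iff_ne_zero_on_residual masterFamilyEqIff_two

end Summit.CriticalPhenomena.PercolationContinuityZ3.Theorems
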